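import Literature.Computability.Complexity.MurrayWilliams2018HeadlineFromThm22
import Literature.Computability.Complexity.InstanceCheckerProofs
import Literature.Computability.Complexity.OracleSimulateFP
import Literature.Computability.Complexity.CountingHierarchyPPoly
import HarnessLib

/-!
# Same-length checkability: from a probabilistic polynomial-time ORACLE MACHINE (as printed) to
# the tree's circuit-description form (`AlmostAE.SameLengthChecker`)

Literature / circuit complexity. Murray–Williams 2018, Thm. 2.2 (after Santhanam 2009 and
Trevisan–Vadhan 2007) asserts a `PSPACE`-complete language `L` that is "checkable in that there
is a probabilistic polynomial-time oracle Turing machine `M` so that, for every input `x`, (1) `M`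
asks its oracle queries only of length `|x|`; (2) if `M` is given `L` as oracle and `x ∈ L`, then
`M` accepts with probability `1`; (3) if `x ∉ L`, then irrespective of the oracle given to `M`, `M`
rejects with probability at least `2/3`" (SIAM J. Comput. 49, p. STOC18-308, Thm. 2.7 there). The
tree's `AlmostAE.SameLengthChecker L` (`MurrayWilliams2018Protocol.lean`) renders this in the form
the protocol `M₁` of Thm. 3.1 consumes: a polynomial-time LANGUAGE `lang` on triples `⟨⟨x, r⟩, d⟩`
(input, coins, circuit description answering the queries through the evaluator
`CircEval.evalFn ⟨q, d⟩`), perfectly complete for every `d` describing the slice of `L` at length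
`|x|` and `1/3`-sound against every `d`. Its docstring argues informally that a printed checker
yields such a language ("run `M` with oracle `q ↦ evalFn ⟨q, d⟩`: by (1) completeness only sees
the slice `d` describes; (3) holds against every oracle, in particular this one"). This file PROVES
that claim over the tree's probabilistic oracle machines (`ProbOracleMachine` =
`Cryptography.OracleAdversary Bool`, `InstanceChecker.lean`; transcript model `OracleAlg`,
`Oracle.lean`), closing the gap between the printed hypothesis and the structure the headline now
rests on (`MurrayWilliams2018_NQP_not_subset_ACC0_of_thm_2_2_language`,
`MurrayWilliams2018HeadlineFromThm22.lean`):

* `OracleAlg.run_congr_oracle` — a run only depends on the oracle's answers to the queries asked;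
* `SLChecker.lang M` — the language `{⟨⟨x, r⟩, d⟩ | M accepts x with coins r ↾ coins(|x|) and
  oracle q ↦ evalFn ⟨q, d⟩ within fuel(|x|) rounds}`, in `P` (`SLChecker.lang_mem_P`: the emulation
  `OracleAlg.simFn` of `OracleSimulateFP.lean` of the clocked, coin-cut machine `BlumKannan.emulate M`,
  queries answered by the `FP` evaluator), with its semantics `SLChecker.mem_lang_iff`;
* **`AlmostAE.SameLengthChecker.ofOracleMachine`** — for `M` probabilistic polynomial-time
  (`IsPPT`) with (1) same-length queries (`hql`, for every oracle and round budget), (2) perfect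
  completeness with oracle `L` (every coin string of length `coins(|x|)` accepts within `fuel(|x|)`
  rounds) and (3) soundness `acceptProbOn ≤ 1/3` against every one-bit oracle, the structure
  `SameLengthChecker L` (coins `M.coins`);
* consequences: `MurrayWilliams2018_NQP_not_subset_ACC0_of_oracleChecker` (the headline from a
  `PSPACE`-hard, paddable, downward self-reducible language without all-ones words checked by such
  a MACHINE) and `MurrayWilliams2018_lemma_4_1_ae_of_oracleChecker_of_umansGenerator` (Lemma 4.1,
  a.e. form, from the same data and a generator of Umans' type).

Design notes. Clause (1) is a property of the machine's code, rendered for every oracle and every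
round budget (`hql`); (2) is pointwise ("accepts with probability 1": every coin string accepts);
(3) quantifies over one-bit oracles `Oracle.ofLanguage A`, the oracles a circuit description can
present (`descLang d`), which is all the construction needs and no more than the source asks.
Theorems and definitions with bodies only; no named fact (D-0026).

## References

* C. D. Murray, R. R. Williams, *Circuit lower bounds for nondeterministic quasi-polytime: an easy
  witness lemma for NP and NQP*, STOC 2018 = SIAM J. Comput. 49 (2020), Thm. 2.2 (SIAM Thm. 2.7),
  Thm. 3.1 ("Merlin provides a circuit `C` and Arthur runs `M^C`") [MurrayWilliams2018].
* R. Santhanam, *Circuit lower bounds for Merlin–Arthur classes*, SIAM J. Comput. 39 (2009)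
  1038–1061; L. Trevisan, S. Vadhan, *Pseudorandomness and average-case complexity via uniform
  reductions*, Comput. Complexity 16 (2007), §4 [TrevisanVadhan2007].
* L. Fortnow, J. Rompel, M. Sipser, *On the power of multi-prover interactive protocols*, Theoret.
  Comput. Sci. 134 (1994), §3 (probabilistic oracle machines) [FortnowRompelSipser1994].
* S. Arora, B. Barak, *Computational Complexity: A Modern Approach*, CUP 2009, §3.4 (oracle
  machines), Thm. 6.18 (circuit evaluation) [AroraBarakCC2009].
-/

noncomputable section

namespace Literature.Computability.Complexity

open _root_.Computability Polynomial CircEval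
open Literature.Computability.Cryptography (OracleAdversary)

/-! ### Oracle runs only depend on the answers to the queries asked -/

namespace OracleAlg

variable {β : Type}

/-- Two oracles agreeing on every query asked along a run give the same run (from any partial
transcript). [cite: AroraBarakCC2009, §3.4] -/
theorem runAux_congr_oracle (N : OracleAlg β) (O O' : Oracle) (x : List Bool) :
    ∀ (k : ℕ) (as : List (List Bool)), (∀ q ∈ N.queriesAux O x k as, O q = O' q) →
      N.runAux O x k as = N.runAux O' x k as
  | 0, _, _ => rfl
  | k + 1, as, h => by
    rw [runAux_succ, runAux_succ]
    unfold queriesAux at h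
    cases hs : N.step x as with
    | inr b => rfl
    | inl q =>
      rw [hs] at h
      dsimp only at h ⊢
      have hq : O q = O' q := h q List.mem_cons_self
      rw [← hq]
      exact runAux_congr_oracle N O O' x k (as ++ [O q]) fun q' hq' => h q' (List.mem_cons_of_mem _ hq')

/-- Two oracles agreeing on every query asked along a run give the same output.
[cite: AroraBarakCC2009, §3.4] -/
theorem run_congr_oracle (N : OracleAlg β) (O O' : Oracle) (k : ℕ) (x : List Bool)
    (h : ∀ q ∈ N.queries O k x, O q = O' q) : N.run O k x = N.run O' k x :=
  runAux_congr_oracle N O O' x k [] h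

end OracleAlg

namespace SLChecker

variable (M : ProbOracleMachine)

/-! ### A circuit description as a one-bit oracle -/

/-- The language decided by a description `d` (read by the evaluator): Merlin's circuit as a
one-bit oracle. [cite: MurrayWilliams2018, Thm. 3.1 ("Merlin provides a circuit C")] -/
def descLang (d : List Bool) : Language Bool := {q | evalFn (boolPair q d) = [true]}

/-- The evaluator's answer on `⟨q, d⟩` is the one-bit oracle of the language described by `d`.
[cite: AroraBarakCC2009, Thm. 6.18] -/
theorem evalFn_eq_ofLanguage (q d : List Bool) :
    evalFn (boolPair q d) = Oracle.ofLanguage (descLang d) q := by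
  change evalFn (boolPair q d) = [(descLang d).boolIndicator q]
  rcases evalFn_eq_or (boolPair q d) with h | h
  · rw [h, (Set.mem_iff_boolIndicator _ _).1 (show q ∈ descLang d from h)]
  · have hq : q ∉ descLang d := fun h' => by
      change evalFn (boolPair q d) = [true] at h'
      rw [h] at h'; simp at h'
    rw [h, (Set.notMem_iff_boolIndicator _ _).1 hq]

/-- A description of the slice of `L` at length `ℓ` presents an oracle that agrees with `L` on
that slice. [cite: MurrayWilliams2018, Thm. 3.1 (proof)] -/
theorem mem_descLang_iff_of_describesSlice {L : Language Bool} {ℓ : ℕ} {d : List Bool}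
    (hd : AlmostAE.DescribesSlice L ℓ d) {q : List Bool} (hq : q.length = ℓ) : q ∈ descLang d ↔ q ∈ L :=
  hd q hq

/-! ### The checker run against a description, as a polynomial-time language -/

/-- The checker as an oracle algorithm with list output (coins cut from the input, clocked by its
own round budget: `BlumKannan.emulate`). [folklore] -/
def chk : OracleAlg (List Bool) := (BlumKannan.emulate M).mapOut fun b => [b]

/-- The checker's verdict on `x` with coins cut from `r` and oracle `O`, within its budget.
[cite: FortnowRompelSipser1994, §3] -/
def accB (O : Oracle) (x r : List Bool) : Bool :=
  (M.alg.run O (M.fuel.eval x.length) (boolPair x (r.take (M.coins.eval x.length)))).getD false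

/-- The verdict bit is `1` iff the checker halts accepting within its budget. [folklore] -/
theorem accB_eq_true_iff (O : Oracle) (x r : List Bool) :
    accB M O x r = true ↔
      M.alg.run O (M.fuel.eval x.length) (boolPair x (r.take (M.coins.eval x.length))) = some true := by
  unfold accB
  cases M.alg.run O (M.fuel.eval x.length) (boolPair x (r.take (M.coins.eval x.length))) with
  | none => simp
  | some b => simp

/-- Run of the list-output checker on `⟨x, r⟩` with enough rounds (`BlumKannan.run_emulate`).
[cite: AroraBarakCC2009, §3.4] -/
theorem run_chk (O : Oracle) (x r : List Bool) {n : ℕ} (hn : M.fuel.eval x.length < n) :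
    (chk M).run O n (boolPair x r) = some [accB M O x r] := by
  unfold chk accB
  change ((BlumKannan.emulate M).mapOut fun b => [b]).runAux O (boolPair x r) n [] = _
  rw [OracleAlg.runAux_mapOut]
  change ((BlumKannan.emulate M).run O n (boolPair x r)).map (fun b => [b]) = _
  rw [BlumKannan.run_emulate M O x r hn]
  rfl

/-- With same-length queries, the emulated checker asks only queries of the input's length.
[cite: MurrayWilliams2018, Thm. 2.2 (clause (1))] -/
theorem length_of_mem_queries_chk
    (hql : ∀ (O : Oracle) (k : ℕ) (x r : List Bool), ∀ q ∈ M.alg.queries O k (boolPair x r), q.length = x.length)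
    (O : Oracle) (n : ℕ) (x r : List Bool) {q : List Bool} (hq : q ∈ (chk M).queries O n (boolPair x r)) :
    q.length = x.length := by
  unfold chk OracleAlg.queries at hq
  rw [OracleAlg.queriesAux_mapOut] at hq
  unfold BlumKannan.emulate OracleAlg.clockFst at hq
  have h1 := OracleAlg.queriesAux_clockBy_subset _ _ _ O (boolPair x r) n [] q hq
  rw [OracleAlg.queriesAux_comap, truncSndFn_boolPair] at h1
  exact hql O n x _ q h1

/-- The answer rule of the emulation: a query `q` on the triple `w = ⟨⟨x, r⟩, d⟩` is answered by
`evalFn ⟨q, d⟩`. [cite: MurrayWilliams2018, Thm. 3.1 ("Arthur runs M^C")] -/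
def ans : List Bool → List Bool := evalFn ∘ fanoutFn sndP (sndP ∘ fstP)

/-- `ans ∈ FP`. [folklore] -/
theorem ans_mem_FP : ans ∈ FP :=
  comp_mem_FP evalFn_mem_FP (fanoutFn_mem_FP sndP_mem_FP (comp_mem_FP sndP_mem_FP fstP_mem_FP))

/-- `ans ⟨w, q⟩ = Oracle.ofLanguage (descLang (snd w)) q`. [folklore] -/
theorem ans_boolPair (w q : List Bool) : ans (boolPair w q) = Oracle.ofLanguage (descLang (sndP w)) q := by
  simp only [ans, Function.comp_apply, fanoutFn_apply, sndP_boolPair, fstP_boolPair]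
  exact evalFn_eq_ofLanguage q (sndP w)

/-- The checker emulated against the description in its input: one `FP` string function on
`w = ⟨⟨x, r⟩, d⟩` (the machine reads `⟨x, r⟩ = fst w`; queries capped at `|w|`, `fuel(|w|) + 1`
rounds). [cite: AroraBarakCC2009, §3.4 Example 3.6 (2)] -/
def langFn : List Bool → List Bool := OracleAlg.simFn (chk M) fstP ans X (M.fuel + 1)

/-- The list-output checker is polynomial time. [folklore] -/
theorem isPolyTime_chk (hM : M.IsPPT encodingBoolBool) : (chk M).IsPolyTime (encodingList Bool) :=
  (BlumKannan.isPolyTime_emulate hM).mapOut (fun b => [b]) fun _ => rfl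

/-- `langFn M ∈ FP`. [cite: AroraBarakCC2009, §3.4 Example 3.6 (2)] -/
theorem langFn_mem_FP (hM : M.IsPPT encodingBoolBool) : langFn M ∈ FP :=
  OracleAlg.simFn_mem_FP (isPolyTime_chk M hM) fstP_mem_FP ans_mem_FP X (M.fuel + 1)

/-- **Semantics of the emulation** on a triple: the checker's verdict on `x` with coins `r` and
oracle the description `d`. [cite: MurrayWilliams2018, Thm. 3.1 ("Arthur runs M^C")] -/
theorem langFn_triple
    (hql : ∀ (O : Oracle) (k : ℕ) (x r : List Bool), ∀ q ∈ M.alg.queries O k (boolPair x r), q.length = x.length)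
    (x r d : List Bool) :
    langFn M (boolPair (boolPair x r) d) = [accB M (Oracle.ofLanguage (descLang d)) x r] := by
  set w := boolPair (boolPair x r) d with hw
  have hO : (fun q => ans (boolPair w q)) = Oracle.ofLanguage (descLang d) := by
    funext q; rw [ans_boolPair, hw, sndP_boolPair]
  have hlen : x.length ≤ w.length := by rw [hw, length_boolPair, length_boolPair]; omega
  unfold langFn
  refine OracleAlg.simFn_eq_of_run ?_ ?_
  · rw [hO, hw, fstP_boolPair, ← hw]
    refine run_chk M _ x r ?_
    simp only [eval_add, eval_one]
    exact Nat.lt_succ_of_le (TM2Iter.eval_mono M.fuel hlen)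
  · intro q hq
    rw [hO, hw, fstP_boolPair, ← hw] at hq
    rw [eval_X, length_of_mem_queries_chk M hql _ _ x r hq]
    exact hlen

/-- **The language of the checker against a description**: the triples `⟨⟨x, r⟩, d⟩` on which
`M`, with coins `r ↾ coins(|x|)` and oracle `q ↦ evalFn ⟨q, d⟩`, accepts within `fuel(|x|)`
rounds. [cite: MurrayWilliams2018, Thm. 2.2 with Thm. 3.1] -/
def lang : Language Bool := {w | langFn M w = [true]}

/-- **It is polynomial time.** [cite: AroraBarakCC2009, §3.4 Example 3.6 (2)] -/
theorem lang_mem_P (hM : M.IsPPT encodingBoolBool) : lang M ∈ Classes.P :=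
  setOf_apply_eq_apply_mem_P (langFn_mem_FP M hM) (const_mem_FP [true])

/-- Membership of a triple in `lang M`. [cite: MurrayWilliams2018, Thm. 2.2 with Thm. 3.1] -/
theorem mem_lang_iff
    (hql : ∀ (O : Oracle) (k : ℕ) (x r : List Bool), ∀ q ∈ M.alg.queries O k (boolPair x r), q.length = x.length)
    (x r d : List Bool) :
    boolPair (boolPair x r) d ∈ lang M ↔
      M.alg.run (Oracle.ofLanguage (descLang d)) (M.fuel.eval x.length)
        (boolPair x (r.take (M.coins.eval x.length))) = some true := by
  change langFn M _ = [true] ↔ _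
  rw [langFn_triple M hql, ← accB_eq_true_iff]
  simp

/-- With same-length queries, a run against a description of the slice at the input length is
the run against the language itself. [cite: MurrayWilliams2018, Thm. 2.2 (clauses (1)–(2))] -/
theorem run_descLang_eq_of_describesSlice
    (hql : ∀ (O : Oracle) (k : ℕ) (x r : List Bool), ∀ q ∈ M.alg.queries O k (boolPair x r), q.length = x.length)
    {L : Language Bool} {d : List Bool} {x : List Bool} (hd : AlmostAE.DescribesSlice L x.length d)
    (k : ℕ) (r : List Bool) :
    M.alg.run (Oracle.ofLanguage (descLang d)) k (boolPair x r) = M.alg.run (Oracle.ofLanguage L) k (boolPair x r) := by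
  refine OracleAlg.run_congr_oracle M.alg _ _ k _ fun q hq => ?_
  have hiff := mem_descLang_iff_of_describesSlice hd (hql _ _ _ _ q hq)
  change [(descLang d).boolIndicator q] = [L.boolIndicator q]
  by_cases hqA : q ∈ descLang d
  · rw [(Set.mem_iff_boolIndicator _ _).1 hqA, (Set.mem_iff_boolIndicator _ _).1 (hiff.1 hqA)]
  · rw [(Set.notMem_iff_boolIndicator _ _).1 hqA,
      (Set.notMem_iff_boolIndicator _ _).1 fun hB => hqA (hiff.2 hB)]

end SLChecker

/-! ### The structure from the machine -/

/-- **Murray–Williams' Theorem 2.2 checkability, machine form ⇒ description form.** A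
probabilistic polynomial-time oracle machine `M` that (1) asks only queries of the input's length,
(2) accepts every `x ∈ L` with probability `1` when given `L` as oracle, and (3) accepts every
`x ∉ L` with probability `≤ 1/3` whatever one-bit oracle it is given, yields the tree's
`AlmostAE.SameLengthChecker L`: Arthur's verdict language is `SLChecker.lang M` (the machine run
with the circuit description as oracle), with `M`'s coin polynomial; completeness for every
description of the slice by (1) (`run_descLang_eq_of_describesSlice`), soundness by (3) against the
described oracle. [cite: MurrayWilliams2018, Thm. 2.2] -/
def AlmostAE.SameLengthChecker.ofOracleMachine (L : Language Bool) (M : ProbOracleMachine)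
    (hM : M.IsPPT encodingBoolBool)
    (hql : ∀ (O : Oracle) (k : ℕ) (x r : List Bool), ∀ q ∈ M.alg.queries O k (boolPair x r), q.length = x.length)
    (hcomp : ∀ x ∈ L, ∀ r : List Bool, r.length = M.coins.eval x.length →
      M.alg.run (Oracle.ofLanguage L) (M.fuel.eval x.length) (boolPair x r) = some true)
    (hsound : ∀ (A : Language Bool) (x : List Bool), x ∉ L → M.acceptProbOn (Oracle.ofLanguage A) x ≤ 1 / 3) :
    AlmostAE.SameLengthChecker L where
  lang := SLChecker.lang M
  mem_P := SLChecker.lang_mem_P M hM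
  coins := M.coins
  complete := by
    intro ℓ d hd x hx hxℓ r hr
    subst hxℓ
    rw [SLChecker.mem_lang_iff M hql, List.take_of_length_le hr.le,
      SLChecker.run_descLang_eq_of_describesSlice M hql hd]
    exact hcomp x hx r hr
  sound := by
    intro x hx d
    have h := hsound (SLChecker.descLang d) x hx
    rw [OracleAdversary.acceptProbOn_eq] at h
    refine le_trans (le_of_eq (uniformProb_congr fun r hr => ?_)) h
    rw [Set.mem_setOf_eq, Set.mem_setOf_eq, SLChecker.mem_lang_iff M hql, List.take_of_length_le hr.le]

/-! ### Consequences: the headline and Lemma 4.1 from a machine-checked complete language -/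

/-- **`NQP ⊄ ACC⁰` from a `PSPACE`-hard, paddable, downward self-reducible language without
all-ones words that is same-length checkable by a probabilistic polynomial-time oracle MACHINE**
(the data of Murray–Williams' Thm. 2.2 as printed), by `SameLengthChecker.ofOracleMachine` and
`MurrayWilliams2018_NQP_not_subset_ACC0_of_thm_2_2_language`.
[cite: MurrayWilliams2018, Thm. 2.2 and §1.1] -/
theorem MurrayWilliams2018_NQP_not_subset_ACC0_of_oracleChecker (Lstar : Language Bool)
    (hhard : IsHard PSPACE Lstar) (hpad : ∀ z : List Bool, true :: z ∈ Lstar ↔ z ∈ Lstar)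
    (hones : ∀ b : ℕ, List.replicate b true ∉ Lstar) (R : AlmostAE.DSR Lstar)
    (M : ProbOracleMachine) (hM : M.IsPPT encodingBoolBool)
    (hql : ∀ (O : Oracle) (k : ℕ) (x r : List Bool), ∀ q ∈ M.alg.queries O k (boolPair x r), q.length = x.length)
    (hcomp : ∀ x ∈ Lstar, ∀ r : List Bool, r.length = M.coins.eval x.length →
      M.alg.run (Oracle.ofLanguage Lstar) (M.fuel.eval x.length) (boolPair x r) = some true)
    (hsound : ∀ (A : Language Bool) (x : List Bool), x ∉ Lstar → M.acceptProbOn (Oracle.ofLanguage A) x ≤ 1 / 3) :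
    MurrayWilliams2018_NQP_not_subset_ACC0 :=
  MurrayWilliams2018_NQP_not_subset_ACC0_of_thm_2_2_language Lstar hhard hpad hones R
    (AlmostAE.SameLengthChecker.ofOracleMachine Lstar M hM hql hcomp hsound)

/-- **Lemma 4.1 (a.e. form) from the same machine data and a generator of Umans' type**
(through `MurrayWilliams2018_lemma_4_1_ae_of_sameLengthChecker_of_umansGenerator`).
[cite: MurrayWilliams2018, Lemma 4.1] -/
theorem MurrayWilliams2018_lemma_4_1_ae_of_oracleChecker_of_umansGenerator (Lstar : Language Bool)
    (hhard : IsHard PSPACE Lstar) (hpad : ∀ z : List Bool, true :: z ∈ Lstar ↔ z ∈ Lstar)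
    (hones : ∀ b : ℕ, List.replicate b true ∉ Lstar) (R : AlmostAE.DSR Lstar)
    (M : ProbOracleMachine) (hM : M.IsPPT encodingBoolBool)
    (hql : ∀ (O : Oracle) (k : ℕ) (x r : List Bool), ∀ q ∈ M.alg.queries O k (boolPair x r), q.length = x.length)
    (hcomp : ∀ x ∈ Lstar, ∀ r : List Bool, r.length = M.coins.eval x.length →
      M.alg.run (Oracle.ofLanguage Lstar) (M.fuel.eval x.length) (boolPair x r) = some true)
    (hsound : ∀ (A : Language Bool) (x : List Bool), x ∉ Lstar → M.acceptProbOn (Oracle.ofLanguage A) x ≤ 1 / 3)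
    (G : UmansGenerator) : MurrayWilliams2018_lemma_4_1_ae :=
  MurrayWilliams2018_lemma_4_1_ae_of_sameLengthChecker_of_umansGenerator Lstar hhard hpad hones R
    (AlmostAE.SameLengthChecker.ofOracleMachine Lstar M hM hql hcomp hsound) G

end Literature.Computability.Complexity

end
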